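import Mathlib
import Summits.Ventures.PercRepro2.V2SP
import Summits.Ventures.PercRepro2.HallOffFrame
import Summits.Ventures.PercRepro2.HallOffAxis
import Summits.Ventures.PercRepro2.Tail2DCount
import Summits.Ventures.PercRepro2.Tail2DThreePoint
import Summits.Ventures.PercRepro2.Tail2DP2Series
import Summits.Ventures.PercRepro2.Tail2DDisjointPaths
import Summits.Ventures.PercRepro2.Tail2DP2SeriesSP
import Summits.Ventures.PercRepro2.Tail2DAxisUnimodal
import Summits.Ventures.PercRepro2.Tail2DOffAxis31
import Summits.Ventures.PercRepro2.Tail2DRowOne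
import Summits.Ventures.PercRepro2.Tail2DStepRowZero
import Summits.Ventures.PercRepro2.Tail2DStepCert
import Summits.Ventures.PercRepro2.Tail2DOffAxisCert
import Summits.Ventures.PercRepro2.Tail2DStepFour
import Summits.Ventures.PercRepro2.Tail2DStepFive
import Summits.Ventures.PercRepro2.Tail2DOffAxisSix
import Summits.Ventures.PercRepro2.Tail2DOffAxisSeven
import Summits.Ventures.PercRepro2.Tail2DOffAxisEight
import Summits.Ventures.PercRepro2.Tail2DOffAxisNine

/-!
# The symbolic-`a` certificate of the column `j = 2` of the off-axis family: the pointwise lemma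
(seat mine-b, cell pub-perc-repro2; MINE-B.md §38)

The weight `phi a 2 r b = [r+1 = a ∧ 3 ≤ b] − [a ≤ r ∧ b = 2]` of a PARALLEL composition (labels
`(r+r', b+b')`) dominates, for every `a ≥ 9`, a sum of 76 products written in coordinates RELATIVE to
`a` (`phi_col2_par_ge`): (cell of one factor) × (hypothesis weight of the other) — the hypotheses being
`phi m 2` for `4 ≤ m ≤ a` (the column itself, the induction hypothesis; the middle block `5 ≤ r ≤ a−4`
of one factor calls the level `a − r` of the other), `phi m 1` for `m ≥ 3` (the row `j = 1`), `phi m 0`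
(the axis family), the count-zero weights `phi 2 1`, `phi 3 2`, `H(0,3) = [3 ≤ b] − [3 ≤ r]` and
`H(1,3) = [1 ≤ r ∧ 3 ≤ b] − [1 ≤ b ∧ 3 ≤ r]` — and six products of two hypotheses.  The certificate
was found by a linear programme over products of low and `a`-relative weights (kit j306894) and
verified exactly for `a = 9 … 16`; the proof is a case analysis on the labels (`b, b' ∈ {0, 1, 2, ≥3}`
and the thirteen regimes `0 … 4`, `[5, a−5]`, `a−4 … a+1`, `≥ a+2` of `r` and `r'`) closed by `omega`.
`Tail2DColTwo.lean` sums it over the product of the configuration spaces and runs the induction.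
-/

namespace Summit.Ventures.PercRepro2.Tail2D

open V2Closure

section Pointwise

/-- `phi m 2 r b = 0` for `b ≤ 1` -/
lemma phi_two_eq_b01 (m r b : ℕ) (hb : b ≤ 1) : phi m 2 r b = 0 := by
  unfold phi; split_ifs <;> omega

/-- `phi m 2 r b = −[m ≤ r]` for `b = 2` -/
lemma phi_two_eq_b2 (m r b : ℕ) (hb : b = 2) : phi m 2 r b = -(if m ≤ r then (1 : ℤ) else 0) := by
  subst hb; unfold phi; split_ifs <;> omega

/-- `phi m 2 r b = [r + 1 = m]` for `b ≥ 3` -/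
lemma phi_two_eq_b3 (m r b : ℕ) (hb : 3 ≤ b) : phi m 2 r b = (if r + 1 = m then (1 : ℤ) else 0) := by
  unfold phi; split_ifs <;> omega

set_option maxHeartbeats 40000000 in
/-- **the pointwise certificate of the parallel step of the column `j = 2`** (`a ≥ 9`): the column weight
of a sum of labels dominates 76 products written relative to `a` -/
theorem phi_col2_par_ge (a r b r' b' : ℕ) (ha : 9 ≤ a) :
      (if r' + 1 = a ∧ b' = 0 then (1 : ℤ) else 0) * ((if 0 ≤ r ∧ 3 ≤ b then (1 : ℤ) else 0) - (if 0 ≤ b ∧ 3 ≤ r then (1 : ℤ) else 0))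
    + (if a + 2 ≤ r' ∧ b' = 0 then (1 : ℤ) else 0) * ((if 1 ≤ r ∧ 3 ≤ b then (1 : ℤ) else 0) - (if 1 ≤ b ∧ 3 ≤ r then (1 : ℤ) else 0))
    + (if r' = a + 1 ∧ b' = 0 then (1 : ℤ) else 0) * ((if 1 ≤ r ∧ 3 ≤ b then (1 : ℤ) else 0) - (if 1 ≤ b ∧ 3 ≤ r then (1 : ℤ) else 0))
    + (if r' = a ∧ b' = 0 then (1 : ℤ) else 0) * ((if 1 ≤ r ∧ 3 ≤ b then (1 : ℤ) else 0) - (if 1 ≤ b ∧ 3 ≤ r then (1 : ℤ) else 0))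
    + (if r' + 2 = a ∧ b' = 0 then (1 : ℤ) else 0) * ((if 1 ≤ r ∧ 3 ≤ b then (1 : ℤ) else 0) - (if 1 ≤ b ∧ 3 ≤ r then (1 : ℤ) else 0))
    + (if 5 ≤ r ∧ r + 4 ≤ a ∧ b = 0 then (1 : ℤ) else 0) * phi (a - r) 2 r' b'
    + (if 5 ≤ r ∧ r + 4 ≤ a ∧ b = 1 then (1 : ℤ) else 0) * phi (a - r) 1 r' b'
    + (if 5 ≤ r' ∧ r' + 4 ≤ a ∧ b' = 0 then (1 : ℤ) else 0) * phi (a - r') 2 r b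
    + (if 5 ≤ r' ∧ r' + 4 ≤ a ∧ b' = 1 then (1 : ℤ) else 0) * phi (a - r') 1 r b
    + (if r = 0 ∧ b = 0 then (1 : ℤ) else 0) * phi a 2 r' b'
    + (if r = 0 ∧ b = 1 then (1 : ℤ) else 0) * phi a 1 r' b'
    + (if r = 0 ∧ b = 2 then (1 : ℤ) else 0) * phi a 0 r' b'
    + (if r = 1 ∧ b = 0 then (1 : ℤ) else 0) * phi (a - 1) 2 r' b'
    + (if r = 1 ∧ b = 1 then (1 : ℤ) else 0) * phi (a - 1) 1 r' b'
    + (if r = 2 ∧ b = 0 then (1 : ℤ) else 0) * phi (a - 2) 2 r' b'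
    + (if r = 2 ∧ b = 1 then (1 : ℤ) else 0) * phi (a - 1) 0 r' b'
    + (if r = 2 ∧ b = 1 then (1 : ℤ) else 0) * phi (a - 2) 1 r' b'
    + (if r = 3 ∧ b = 0 then (1 : ℤ) else 0) * phi (a - 3) 2 r' b'
    + (if r = 3 ∧ b = 1 then (1 : ℤ) else 0) * phi (a - 1) 0 r' b'
    + (if r = 3 ∧ b = 1 then (1 : ℤ) else 0) * phi (a - 2) 1 r' b'
    + (if r = 4 ∧ b = 0 then (1 : ℤ) else 0) * phi (a - 3) 2 r' b'
    + (if r = 4 ∧ b = 1 then (1 : ℤ) else 0) * phi (a - 1) 0 r' b'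
    + (if r = 4 ∧ b = 1 then (1 : ℤ) else 0) * phi (a - 2) 1 r' b'
    + (if a + 2 ≤ r ∧ b = 0 then (1 : ℤ) else 0) * ((if 1 ≤ r' ∧ 3 ≤ b' then (1 : ℤ) else 0) - (if 1 ≤ b' ∧ 3 ≤ r' then (1 : ℤ) else 0))
    + (if a + 2 ≤ r ∧ b = 0 then (1 : ℤ) else 0) * phi (a - 3) 1 r' b'
    + (if a + 2 ≤ r ∧ b = 1 then (1 : ℤ) else 0) * phi 4 0 r' b'
    + (if r = a + 1 ∧ b = 0 then (1 : ℤ) else 0) * ((if 1 ≤ r' ∧ 3 ≤ b' then (1 : ℤ) else 0) - (if 1 ≤ b' ∧ 3 ≤ r' then (1 : ℤ) else 0))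
    + (if r = a + 1 ∧ b = 0 then (1 : ℤ) else 0) * phi (a - 3) 1 r' b'
    + (if r = a + 1 ∧ b = 1 then (1 : ℤ) else 0) * phi 4 0 r' b'
    + (if r = a ∧ b = 0 then (1 : ℤ) else 0) * ((if 1 ≤ r' ∧ 3 ≤ b' then (1 : ℤ) else 0) - (if 1 ≤ b' ∧ 3 ≤ r' then (1 : ℤ) else 0))
    + (if r = a ∧ b = 0 then (1 : ℤ) else 0) * phi (a - 3) 1 r' b'
    + (if r = a ∧ b = 1 then (1 : ℤ) else 0) * phi 4 0 r' b'
    + (if r + 1 = a ∧ b = 0 then (1 : ℤ) else 0) * ((if 0 ≤ r' ∧ 3 ≤ b' then (1 : ℤ) else 0) - (if 0 ≤ b' ∧ 3 ≤ r' then (1 : ℤ) else 0))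
    + (if r + 1 = a ∧ b = 0 then (1 : ℤ) else 0) * phi (a - 3) 1 r' b'
    + (if r + 1 = a ∧ b = 1 then (1 : ℤ) else 0) * phi 4 0 r' b'
    + (if r + 2 = a ∧ b = 0 then (1 : ℤ) else 0) * ((if 1 ≤ r' ∧ 3 ≤ b' then (1 : ℤ) else 0) - (if 1 ≤ b' ∧ 3 ≤ r' then (1 : ℤ) else 0))
    + (if r + 2 = a ∧ b = 1 then (1 : ℤ) else 0) * phi 4 0 r' b'
    + (if r + 3 = a ∧ b = 0 then (1 : ℤ) else 0) * phi 3 2 r' b'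
    + (if r + 3 = a ∧ b = 1 then (1 : ℤ) else 0) * phi 4 0 r' b'
    + (if 5 ≤ r ∧ r + 4 ≤ a ∧ b = 1 then (1 : ℤ) else 0) * phi (a - 1) 0 r' b'
    + phi 2 1 r b * phi (a - 1) 0 r' b'
    + phi 3 1 r b * phi (a - 2) 0 r' b'
    + (if r' + 3 = a ∧ b' = 0 then (1 : ℤ) else 0) * phi 3 2 r b
    + (if a + 2 ≤ r' ∧ b' = 1 then (1 : ℤ) else 0) * phi 4 0 r b
    + (if r' = a + 1 ∧ b' = 1 then (1 : ℤ) else 0) * phi 4 0 r b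
    + (if r' = a ∧ b' = 1 then (1 : ℤ) else 0) * phi 4 0 r b
    + (if r' + 1 = a ∧ b' = 1 then (1 : ℤ) else 0) * phi 4 0 r b
    + (if r' + 2 = a ∧ b' = 1 then (1 : ℤ) else 0) * phi 4 0 r b
    + (if r' + 3 = a ∧ b' = 1 then (1 : ℤ) else 0) * phi 4 0 r b
    + phi 4 0 r b * phi (a - 3) 1 r' b'
    + (if r' = 0 ∧ b' = 2 then (1 : ℤ) else 0) * phi a 0 r b
    + (if r' = 0 ∧ b' = 1 then (1 : ℤ) else 0) * phi a 1 r b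
    + (if r' = 0 ∧ b' = 0 then (1 : ℤ) else 0) * phi a 2 r b
    + (if r' = 2 ∧ b' = 1 then (1 : ℤ) else 0) * phi (a - 1) 0 r b
    + (if r' = 3 ∧ b' = 1 then (1 : ℤ) else 0) * phi (a - 1) 0 r b
    + (if r' = 4 ∧ b' = 1 then (1 : ℤ) else 0) * phi (a - 1) 0 r b
    + (if 5 ≤ r' ∧ r' + 4 ≤ a ∧ b' = 1 then (1 : ℤ) else 0) * phi (a - 1) 0 r b
    + phi (a - 1) 0 r b * phi 2 1 r' b'
    + (if r' = 1 ∧ b' = 1 then (1 : ℤ) else 0) * phi (a - 1) 1 r b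
    + (if a + 2 ≤ r' ∧ b' = 1 then (1 : ℤ) else 0) * phi (a - 1) 1 r b
    + (if r' = a + 1 ∧ b' = 1 then (1 : ℤ) else 0) * phi (a - 1) 1 r b
    + (if r' = a ∧ b' = 1 then (1 : ℤ) else 0) * phi (a - 1) 1 r b
    + (if r' + 1 = a ∧ b' = 1 then (1 : ℤ) else 0) * phi (a - 1) 1 r b
    + (if r' = 1 ∧ b' = 0 then (1 : ℤ) else 0) * phi (a - 1) 2 r b
    + phi (a - 2) 0 r b * phi 3 1 r' b'
    + (if r' = 2 ∧ b' = 1 then (1 : ℤ) else 0) * phi (a - 2) 1 r b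
    + (if r' = 3 ∧ b' = 1 then (1 : ℤ) else 0) * phi (a - 2) 1 r b
    + (if r' = 4 ∧ b' = 1 then (1 : ℤ) else 0) * phi (a - 2) 1 r b
    + (if r' = 2 ∧ b' = 0 then (1 : ℤ) else 0) * phi (a - 2) 2 r b
    + (if a + 2 ≤ r' ∧ b' = 0 then (1 : ℤ) else 0) * phi (a - 3) 1 r b
    + (if r' = a + 1 ∧ b' = 0 then (1 : ℤ) else 0) * phi (a - 3) 1 r b
    + (if r' = a ∧ b' = 0 then (1 : ℤ) else 0) * phi (a - 3) 1 r b
    + (if r' + 1 = a ∧ b' = 0 then (1 : ℤ) else 0) * phi (a - 3) 1 r b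
    + phi (a - 3) 1 r b * phi 4 0 r' b'
    + (if r' = 3 ∧ b' = 0 then (1 : ℤ) else 0) * phi (a - 3) 2 r b
    + (if r' = 4 ∧ b' = 0 then (1 : ℤ) else 0) * phi (a - 3) 2 r b
    ≤ phi a 2 (r + r') (b + b') := by
  rcases (by omega : b = 0 ∨ b = 1 ∨ b = 2 ∨ 3 ≤ b) with rfl | rfl | rfl | hb <;>
  rcases (by omega : b' = 0 ∨ b' = 1 ∨ b' = 2 ∨ 3 ≤ b') with rfl | rfl | rfl | hb' <;>
  simp (disch := omega) only [phi_zero_eq_b0, phi_zero_eq_b1, phi_one_eq_b0, phi_one_eq_b1, phi_one_eq_b2,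
    phi_two_eq_b01, phi_two_eq_b2, phi_two_eq_b3, if_pos, if_neg, and_true, mul_zero, zero_mul,
    add_zero, zero_add, mul_neg, neg_zero, zero_sub, sub_self] <;>
  rcases (by omega : r = 0 ∨ r = 1 ∨ r = 2 ∨ r = 3 ∨ r = 4 ∨ (5 ≤ r ∧ r + 5 ≤ a) ∨ r + 4 = a ∨ r + 3 = a ∨
      r + 2 = a ∨ r + 1 = a ∨ r = a ∨ r = a + 1 ∨ a + 2 ≤ r) with
    rfl | rfl | rfl | rfl | rfl | hr | hr | hr | hr | hr | hr | rfl | hr <;>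
  (try simp (disch := omega) only [if_pos, if_neg, mul_zero, zero_mul, add_zero, zero_add,
    mul_one, one_mul, neg_zero, sub_zero, sub_self]) <;>
  rcases (by omega : r' = 0 ∨ r' = 1 ∨ r' = 2 ∨ r' = 3 ∨ r' = 4 ∨ (5 ≤ r' ∧ r' + 5 ≤ a) ∨ r' + 4 = a ∨ r' + 3 = a ∨
      r' + 2 = a ∨ r' + 1 = a ∨ r' = a ∨ r' = a + 1 ∨ a + 2 ≤ r') with
    rfl | rfl | rfl | rfl | rfl | hr' | hr' | hr' | hr' | hr' | hr' | rfl | hr' <;>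
  (try simp (disch := omega) only [if_pos, if_neg, mul_zero, zero_mul, add_zero, zero_add,
    mul_one, one_mul, neg_zero, sub_zero, sub_self]) <;>
  (try split_ifs) <;> omega

end Pointwise

end Summit.Ventures.PercRepro2.Tail2D
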